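import Summits.QuantumFields.BalabanUV.Beta.EriceFlowEnclosureB12AsPrintedPointwiseFadingOrderSharp

/-!
# Beta / EriceFlowEnclosureB12AsPrintedPointwiseFadingOrderSharpEnd — WHAT (0.31) FORCES POINTWISE, part 7♯ END: the sharp-box separation of
# `…PointwiseFadingOrderSharp` (order and same-length uniqueness SIGN-FREE under `HistLipschitz Λ γ β` + `FadingMemory C θ Λ`, 0 < θ < 1, in every box with
# **Cγ³ ≤ 2(1 − √θ)²**, ratio √θ) READ ON THE STATEMENT-EXACT CARRIER `B12BetaAsPrinted`: «g₀ = g₀(ε, g)» is a strictly increasing FUNCTION of g in the sharp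
# box (**`bareCoupling_unique_sqrt`**, **`bareCoupling_strictMono_sqrt`**), local uniqueness near zero coupling from `Definitions` + prover 1's binder `hrg` +
# the moduli ALONE with the explicit radius min(γ_U, 1, 2(1−√θ)²∕(C+1)) (**`localUnique_sqrt`**; part 7 had (1−θ)²∕(4C+1)), and the END
# **`theorem2_existsUnique_of_fadingMemory_sqrt`**: `Theorem2Statement` AS TYPED + `Definitions` + (U) + the moduli + ONE box with b′γ₁² < 1 and Cγ₁³ ≤ 2(1−√θ)²
# ⟹ «∃! g₀» on every lattice — part 7's `theorem2_existsUnique_of_fadingMemory_signFree` (4Cγ₁³ ≤ (1−θ)²) in the larger box, prover 1's #61e without the AF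
# letter (β-flow team, prover 2 = lower ∕ positivity side, unit `b2b-balaban-beta-bflow-p2`, gen 45; ROW AP-I × node U2's letters)

HONEST FRAMING (page 1 of everything the β sub-cell writes): discharging `BetaPertH` makes Bałaban's UV stability UNCONDITIONAL — a
real constructive-QFT result; it is NOT the continuum limit and NOT the Clay problem.  HONEST DEPENDENCY (cell reorg 2026-08-19,
verbatim): «continuum YM on T⁴ ⇐ BetaPertH ∧ nine spine estimates (0/9 proved); BetaPertH ⇐ (D1) ∧ (D4) ∧ CAP+tail; G-an2-4 gates
asym, D1 and NE2/3/4.»  THIS MODULE DISCHARGES NOTHING: it reads the elementary separation theorem of `…PointwiseFadingOrderSharp` (two real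
sequences obeying (0.20) of [I] = T. Bałaban, Commun. Math. Phys. **109** (1987) [Balaban1987RG1] p. 256 for an ABSTRACT history-dependent
`β : FlowStep.HBeta`, p. 298, under node U2's UNPRINTED hypothesis shapes `HistLipschitz` ∕ `FadingMemory`, GAPS G-t4-U2-2) on the carrier through the
printed `Definitions` ((0.18): a run starts at its bare coupling) and, for the END, `Theorem2Statement` (STATED WITHOUT PROOF, p. 259;
[Balaban1989LargeFieldII] p. 355) as a HYPOTHESIS.  Uniqueness of g₀ is NOT printed in [I] (custodian's `beta/asprinted/DELTA-I.md` D-21: Theorem 2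
is an existence statement, the tree types `∃`); where it holds it is the consumer's theorem under the consumer's modulus.

WHAT THIS FILE PROVES (0 sorry, 0 def): **`bareCoupling_unique_sqrt`**, **`bareCoupling_strictMono_sqrt`**, **`localUnique_sqrt`**,
**`theorem2_existsUnique_of_fadingMemory_sqrt`**.
NOT CLAIMED: any modulus, sign or bound for Bałaban's β; which reading print intends; Theorem 2; `BetaPertH`; continuum; Clay.
-/

namespace Summit.QuantumFields.BalabanUV.Beta.EriceFlowEnclosureB12AsPrintedPointwiseFadingOrderSharpEnd

open Literature.MathematicalPhysics.QuantumFieldTheory.Balaban1983to89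
open Literature.MathematicalPhysics.QuantumFieldTheory.Balaban1983to89.B12BetaAsPrinted
open Literature.MathematicalPhysics.QuantumFieldTheory.Balaban1983to89.FlowStep (HBeta prefixOf Box mem_box box_mono RGEqH BetaUpperH)
open Literature.MathematicalPhysics.QuantumFieldTheory.Balaban1983to89.T4CouplingMatching (HistLipschitz FadingMemory)
open Summit.QuantumFields.BalabanUV.Beta.EriceFlowEnclosureB12AsPrintedUpper (tunedRuns_of_theorem2Statement)
open Summit.QuantumFields.BalabanUV.Beta.EriceFlowEnclosureB12AsPrintedTunedUpper (hrg_of_betaUpperH)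
open Summit.QuantumFields.BalabanUV.Beta.EriceFlowEnclosureB12AsPrintedPointwiseFadingOrderSharp

noncomputable section

/-! ## §1 On the as-printed carrier: «g₀ = g₀(ε, g)» is a strictly increasing FUNCTION in the sharp box -/

variable {S : Setting}

/-- **«g₀(ε, g)» IS A FUNCTION UNDER FADING MEMORY IN THE SHARP BOX.**  For a setting with the printed `Definitions` ((0.18): runs start at their bare coupling):
two runs (K, m, g₀), (K, m, g₀′) obeying (0.20), staying in ]0, γ] and ending at the SAME renormalized coupling have the SAME bare coupling (and coincide at
every scale), provided `HistLipschitz Λ γ S.β` with `FadingMemory C θ Λ` (0 < θ < 1, 0 ≤ C) and `Cγ³ ≤ 2(1 − √θ)²`.  Part 7's `bareCoupling_unique_signFree` in the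
larger box. [cite: Balaban1987RG1, Thm 2 p.259 («g₀ = g₀(ε, g)») with (0.18)–(0.20) pp.255–256 and p.298] -/
theorem bareCoupling_unique_sqrt (hD : Definitions S) {γ θ C : ℝ} {Λ : ℕ → ℕ → ℝ}
    (hθ0 : 0 < θ) (hθ1 : θ < 1) (hC : 0 ≤ C) (hL : HistLipschitz Λ γ S.β) (hΛ : FadingMemory C θ Λ)
    (hsmall : C * γ ^ 3 ≤ 2 * (1 - Real.sqrt θ) ^ 2) {K m : ℕ} {g₀ g₀' : ℝ}
    (hrg : RGEqH K S.β (S.cpl ⟨K, m, g₀⟩)) (hrg' : RGEqH K S.β (S.cpl ⟨K, m, g₀'⟩))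
    (hI : Step.InInterval γ K (S.cpl ⟨K, m, g₀⟩)) (hI' : Step.InInterval γ K (S.cpl ⟨K, m, g₀'⟩))
    (hpin : S.cpl ⟨K, m, g₀⟩ K = S.cpl ⟨K, m, g₀'⟩ K) :
    g₀ = g₀' ∧ ∀ j, j ≤ K → S.cpl ⟨K, m, g₀⟩ j = S.cpl ⟨K, m, g₀'⟩ j := by
  have hall := runs_eq_of_fadingMemory_sqrt hθ0 hθ1 hC hrg hrg' hI hI' hL hΛ hsmall hpin
  refine ⟨?_, hall⟩
  have h0 := hall 0 (Nat.zero_le K)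
  rwa [hD.d018, hD.d018] at h0

/-- **ORDER OF BARE COUPLINGS = ORDER OF EFFECTIVE COUPLINGS IN THE SHARP BOX.**  Same letters as `bareCoupling_unique_sqrt`: g₀ < g₀′ ⟹ g_j < g′_j at EVERY scale
j ≤ K of two in-]0, γ]-interval runs of the same length obeying (0.20). [cite: Balaban1987RG1, Thm 2 p.259 («g₀ = g₀(ε, g)») with (0.18)–(0.20) pp.255–256 and p.298] -/
theorem bareCoupling_strictMono_sqrt (hD : Definitions S) {γ θ C : ℝ} {Λ : ℕ → ℕ → ℝ}
    (hθ0 : 0 < θ) (hθ1 : θ < 1) (hC : 0 ≤ C) (hL : HistLipschitz Λ γ S.β) (hΛ : FadingMemory C θ Λ)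
    (hsmall : C * γ ^ 3 ≤ 2 * (1 - Real.sqrt θ) ^ 2) {K m : ℕ} {g₀ g₀' : ℝ}
    (hrg : RGEqH K S.β (S.cpl ⟨K, m, g₀⟩)) (hrg' : RGEqH K S.β (S.cpl ⟨K, m, g₀'⟩))
    (hI : Step.InInterval γ K (S.cpl ⟨K, m, g₀⟩)) (hI' : Step.InInterval γ K (S.cpl ⟨K, m, g₀'⟩))
    (hlt : g₀ < g₀') : ∀ j, j ≤ K → S.cpl ⟨K, m, g₀⟩ j < S.cpl ⟨K, m, g₀'⟩ j := by
  have h0 : S.cpl ⟨K, m, g₀⟩ 0 < S.cpl ⟨K, m, g₀'⟩ 0 := by rw [hD.d018, hD.d018]; exact hlt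
  exact order_preserved_sqrt hθ0 hθ1 hC hrg hrg' hI hI' hL hΛ hsmall h0

/-- **LOCAL UNIQUENESS NEAR ZERO FROM THE MODULI ALONE, SHARP-BOX SIZE.**  `Definitions` + prover 1's binder `hrg` on ]0, γ_U] + `HistLipschitz Λ γ_U S.β` with
`FadingMemory C θ Λ` (0 < θ < 1, 0 ≤ C) ⟹ with the EXPLICIT g₂ := min(γ_U, 1, 2(1−√θ)²∕(C+1)) (part 7 had (1−θ)²∕(4C+1)), in-]0, g₂]-interval runs of the same length
with a common endpoint have the same bare coupling. [cite: Balaban1987RG1, Thm 2 p.259 («g₀ = g₀(ε, g)») with (0.18)–(0.20) pp.255–256 and p.298] -/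
theorem localUnique_sqrt (hD : Definitions S) {m : ℕ} {γU θ C : ℝ} {Λ : ℕ → ℕ → ℝ}
    (hθ0 : 0 < θ) (hθ1 : θ < 1) (hC : 0 ≤ C) (hγU : 0 < γU)
    (hrg : ∀ P : B12.RunParams, Step.InInterval γU P.K (S.cpl P) → RGEqH P.K S.β (S.cpl P))
    (hL : HistLipschitz Λ γU S.β) (hΛ : FadingMemory C θ Λ) :
    ∀ (K : ℕ) (g₀ g₀' : ℝ), Step.InInterval (min γU (min 1 (2 * (1 - Real.sqrt θ) ^ 2 / (C + 1)))) K (S.cpl ⟨K, m, g₀⟩) →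
      Step.InInterval (min γU (min 1 (2 * (1 - Real.sqrt θ) ^ 2 / (C + 1)))) K (S.cpl ⟨K, m, g₀'⟩) →
      S.cpl ⟨K, m, g₀⟩ K = S.cpl ⟨K, m, g₀'⟩ K → g₀ = g₀' := by
  have hs1 : Real.sqrt θ < 1 := by
    rw [← Real.sqrt_one]; exact Real.sqrt_lt_sqrt hθ0.le hθ1
  have h1s : 0 < (1 - Real.sqrt θ) ^ 2 := by
    have : 0 < 1 - Real.sqrt θ := by linarith
    positivity
  set r : ℝ := 2 * (1 - Real.sqrt θ) ^ 2 / (C + 1) with hr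
  have hrpos : 0 < r := by rw [hr]; positivity
  set g₂ : ℝ := min γU (min 1 r) with hg₂
  have hg₂pos : 0 < g₂ := lt_min hγU (lt_min one_pos hrpos)
  have hg₂U : g₂ ≤ γU := min_le_left _ _
  have hg₂1 : g₂ ≤ 1 := (min_le_right _ _).trans (min_le_left _ _)
  have hg₂r : g₂ ≤ r := (min_le_right _ _).trans (min_le_right _ _)
  have hsmall : C * g₂ ^ 3 ≤ 2 * (1 - Real.sqrt θ) ^ 2 := by
    have hcube : g₂ ^ 3 ≤ g₂ := by
      calc g₂ ^ 3 = g₂ * g₂ ^ 2 := by ring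
        _ ≤ g₂ * 1 := mul_le_mul_of_nonneg_left (pow_le_one₀ hg₂pos.le hg₂1) hg₂pos.le
        _ = g₂ := mul_one _
    calc C * g₂ ^ 3 ≤ C * g₂ := mul_le_mul_of_nonneg_left hcube hC
      _ ≤ C * r := mul_le_mul_of_nonneg_left hg₂r hC
      _ = C * (2 * (1 - Real.sqrt θ) ^ 2) / (C + 1) := by rw [hr]; ring
      _ ≤ 2 * (1 - Real.sqrt θ) ^ 2 := by
          rw [div_le_iff₀ (by positivity)]; nlinarith
  intro K g₀ g₀' hI hI' he
  have hLg : HistLipschitz Λ g₂ S.β := fun k p q hp hq => hL k p q (box_mono hg₂U k hp) (box_mono hg₂U k hq)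
  have hIU : Step.InInterval γU K (S.cpl ⟨K, m, g₀⟩) := fun i hi => ⟨(hI i hi).1, (hI i hi).2.trans hg₂U⟩
  have hIU' : Step.InInterval γU K (S.cpl ⟨K, m, g₀'⟩) := fun i hi => ⟨(hI' i hi).1, (hI' i hi).2.trans hg₂U⟩
  exact (bareCoupling_unique_sqrt hD hθ0 hθ1 hC hLg hΛ hsmall (hrg ⟨K, m, g₀⟩ hIU) (hrg ⟨K, m, g₀'⟩ hIU')
    hI hI' he).1

/-- **END — THEOREM 2's «g₀ = g₀(ε, g)» EXISTS AND IS UNIQUE UNDER FADING MEMORY IN THE SHARP BOX, TYPED READING, NO AF LETTER.**  `Theorem2Statement S hL` ([I]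
Theorem 2 AS PRINTED and AS TYPED — `Missing.B12Thm2Shape`: «there exist constants β, β′» AFTER «for a sufficiently small positive g» — a HYPOTHESIS), the
printed `Definitions`, the box-wide upper letter `β_{k+1} ≤ b′` on ]0, γ_u]^{k+1} (p. 264 «uniformly bounded»; used only to put (0.20) on in-interval runs,
`…TunedUpper.hrg_of_betaUpperH`), moduli `HistLipschitz Λ γ_u S.β` with `FadingMemory C θ Λ` (0 < θ < 1, 0 ≤ C), and ONE box size γ₁ ≤ γ_u with b′γ₁² < 1 and
**`Cγ₁³ ≤ 2(1 − √θ)²`** ⟹ for every m there is γ₂ > 0 such that for every γ ≤ γ₂ there is g₁ > 0 such that for every g ∈ ]0, g₁] and EVERY K there is EXACTLY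
ONE bare coupling g₀ whose run (K, m, g₀) stays in ]0, γ] and ends at g_K = g.  Part 7's `theorem2_existsUnique_of_fadingMemory_signFree` in the larger box;
existence is Theorem 2's, uniqueness is §1.  A REDUCTION over UNPRINTED letters; nothing of [I] asserted. [cite: Balaban1987RG1, Thm 2 (0.31) p.259 with (0.20) p.256, §1 p.264 and p.298] -/
theorem theorem2_existsUnique_of_fadingMemory_sqrt {hL : Odd S.L ∧ 1 < S.L} (h : Theorem2Statement S hL) (hD : Definitions S)
    {γu γ₁ b' θ C : ℝ} {Λ : ℕ → ℕ → ℝ} (hup : BetaUpperH b' γu S.β)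
    (hL' : HistLipschitz Λ γu S.β) (hΛ : FadingMemory C θ Λ) (hθ0 : 0 < θ) (hθ1 : θ < 1) (hC : 0 ≤ C)
    (hγ₁ : 0 < γ₁) (hγ₁u : γ₁ ≤ γu) (hbu : b' * γ₁ ^ 2 < 1) (hsmall : C * γ₁ ^ 3 ≤ 2 * (1 - Real.sqrt θ) ^ 2) (m : ℕ) :
    ∃ γ₂ : ℝ, 0 < γ₂ ∧ ∀ γ : ℝ, 0 < γ → γ ≤ γ₂ → ∃ g₁ : ℝ, 0 < g₁ ∧ ∀ g : ℝ, 0 < g → g ≤ g₁ → ∀ K : ℕ,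
      ∃! g₀ : ℝ, Step.InInterval γ K (S.cpl ⟨K, m, g₀⟩) ∧ S.cpl ⟨K, m, g₀⟩ K = g := by
  obtain ⟨γ₀, hγ₀, hγ⟩ := tunedRuns_of_theorem2Statement h m
  refine ⟨min γ₀ γ₁, lt_min hγ₀ hγ₁, fun γ hγpos hγle => ?_⟩
  have hγ₀le : γ ≤ γ₀ := hγle.trans (min_le_left _ _)
  have hγ₁le : γ ≤ γ₁ := hγle.trans (min_le_right _ _)
  have hγule : γ ≤ γu := hγ₁le.trans hγ₁u
  obtain ⟨g₁, hg₁, hg⟩ := hγ γ hγpos hγ₀le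
  refine ⟨g₁, hg₁, fun g hgpos hgle K => ?_⟩
  obtain ⟨β, β', -, -, hK⟩ := hg g hgpos hgle
  obtain ⟨g₀, hI, hend, -⟩ := hK K
  have hup' : BetaUpperH b' γ S.β := fun k v hv => hup k v (box_mono hγule k hv)
  have hLγ : HistLipschitz Λ γ S.β := fun k p q hp hq => hL' k p q (box_mono hγule k hp) (box_mono hγule k hq)
  have hγsq : γ ^ 2 ≤ γ₁ ^ 2 := pow_le_pow_left₀ hγpos.le hγ₁le 2
  have hbγ : b' * γ ^ 2 < 1 := by
    rcases le_or_gt 0 b' with hb' | hb'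
    · exact lt_of_le_of_lt (mul_le_mul_of_nonneg_left hγsq hb') hbu
    · nlinarith [sq_nonneg γ]
  have hsmallγ : C * γ ^ 3 ≤ 2 * (1 - Real.sqrt θ) ^ 2 :=
    (mul_le_mul_of_nonneg_left (pow_le_pow_left₀ hγpos.le hγ₁le 3) hC).trans hsmall
  refine ⟨g₀, ⟨hI, hend⟩, fun y hy => ?_⟩
  obtain ⟨hIy, hendy⟩ := hy
  exact (bareCoupling_unique_sqrt hD hθ0 hθ1 hC hLγ hΛ hsmallγ
    (hrg_of_betaUpperH hD hγpos hup' hbγ ⟨K, m, y⟩ hIy) (hrg_of_betaUpperH hD hγpos hup' hbγ ⟨K, m, g₀⟩ hI)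
    hIy hI (hendy.trans hend.symm)).1

end

end Summit.QuantumFields.BalabanUV.Beta.EriceFlowEnclosureB12AsPrintedPointwiseFadingOrderSharpEnd
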